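import Summits.NavierStokesRegularity.NavierStokesRegularity.Theorems.WakeRatchetEternalViscousRateCircuitPumpClock
import Summits.NavierStokesRegularity.NavierStokesRegularity.Theorems.WakeRatchetEternalViscousRateCircuitPumpTable
import Summits.NavierStokesRegularity.NavierStokesRegularity.Theorems.WakeRatchetEternalViscousRateCircuitPumpRenorm

/-!
# `WakeRatchet.EternalViscousRate` (stmt-NavierStokesRegularity-25647): ASSEMBLY of the bridge
# «perpetual-pump witness ⟹ dissipation-balanced block-DSS bounded admissible eternal solution» MODULO its two
# remaining analytic inputs (per-shell action, boundedness near the blow-up time)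

Composition of the landed bricks `WakeRatchetCircuitPumpClock` (lattice type-I clock), `WakeRatchetCircuitPumpTable`
(encoding dictionary) and `WakeRatchetCircuitPumpRenorm` (renormalisation): for ANY witness of the clauses of
`PerpetualPump.CircuitPump` at scale parameter `lam > 1` with period `k = 1` — a solution `X` of the viscous circuit
(`SolvesODE lam coeff X`) that is exactly self-similar (`IsDSS lam 1 X`), Type I (`IsTypeI lam X`) and non-trivial — and
GIVEN the two inputs still to be proved for the pump,
  (hact) uniform per-shell action `Λ^n ∫_{t<0} ‖x_n‖ ≤ M` (brick 3: `WakeRatchetCircuitPumpFarPast.typeI_farPast_bound` supplies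
         the far-past half; the packaging is open),
  (hbd)  boundedness of every shell vector on `[-1/2, 0)` (= `CircuitPumpNegative.typeI_critical_bound`, whose module is not
         importable on the farm at the time of writing),
the renormalised family `W_n(σ) = Λ^n e^{-σ} x_n(-e^{-σ})`, `Λ = lam = (1+ε₀)^{5/2}`, `ε₀ = lam^{2/5} - 1 > 0`, is an admissible
eternal solution with covariant viscosity `ν̂ = 1` of the pulled-back Tao-class table, UNIFORMLY BOUNDED, BLOCK-SELF-SIMILAR with
the pinned lag `T = 2 log(1+ε₀)`, and NON-TRIVIAL (`viscousBlockDSS_of_pumpWitness`) — i.e. exactly an instance, at scale ratio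
`1+ε₀` and on the witness's table, of the object quantified in the kill hypothesis `ViscousBlockDSSWaves` of ⟨25647⟩ (up to the
zero-padding `m ⊂ 4`).  With `PerpetualPumpCircuitPump.CircuitPump_proof` (every `lam₀ > 1` admits such a witness with
`lam < lam₀`, table = seeded graded Toda ∈ `InTableClass (2/ε(lam))` by `WakeRatchetCircuitPumpTodaClass`) this is the route
to the Negative lemma «`EternalViscousRate` has no spread-uniform threshold».
HONEST LABEL: MODEL lattice ODEs only (Tao 2016 §4, §6.4); conditional on (hact), (hbd); no item is closed; nothing here
bears on the Navier–Stokes equations.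
-/

set_option linter.dupNamespace false

noncomputable section

open scoped BigOperators
open Real Set Filter Topology MeasureTheory

namespace Summit.NavierStokesRegularity.NavierStokesRegularity.Theorems.WakeRatchetCircuitPumpAssembly

open Summit.NavierStokesRegularity.NavierStokesRegularity.Theorems.CircuitPumpNegative
open Summit.NavierStokesRegularity.NavierStokesRegularity.Theorems.WakeRatchetCircuitPumpClock
open Summit.NavierStokesRegularity.NavierStokesRegularity.Theorems.WakeRatchetCircuitPumpTable
open Summit.NavierStokesRegularity.NavierStokesRegularity.Theorems.WakeRatchetCircuitPumpRenorm
open Literature.Analysis.FluidPDE Literature.Analysis.FluidPDE.TaoCascade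

variable {m : ℕ}

/-- `ε₀ = lam^{2/5} - 1` inverts `lam = (1+ε₀)^{5/2}`: positivity and `bigLam ε₀ = lam`. [folklore] -/
theorem eps_of_lam {lam : ℝ} (hlam : 1 < lam) :
    0 < lam ^ (2 / 5 : ℝ) - 1 ∧ (1 + (lam ^ (2 / 5 : ℝ) - 1)) ^ ((5 : ℝ) / 2) = lam ∧
      bigLam (lam ^ (2 / 5 : ℝ) - 1) = lam := by
  have hpos : 0 < lam := by linarith
  have h1 : 1 < lam ^ (2 / 5 : ℝ) := Real.one_lt_rpow hlam (by norm_num)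
  have h2 : (1 + (lam ^ (2 / 5 : ℝ) - 1)) ^ ((5 : ℝ) / 2) = lam := by
    rw [add_sub_cancel, ← Real.rpow_mul hpos.le]
    norm_num
  exact ⟨by linarith, h2, h2⟩

/-- **The bridge, modulo (hact) and (hbd).**  See the module docstring.  The conclusion lists: the admissible eternal
solution with covariant viscosity `1` of the pulled-back table (`IsEternalVisc`), `UniformBound`, the block-DSS relation with
lag `2 log(1+ε₀)`, and non-triviality.
[cite: Tao2016AveragedNS, §4 Thm. 4.2 (statement shape), the viscous equation before it, §6.4; cell vocabulary (`IsEternalVisc`, `UniformBound`)] -/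
theorem viscousBlockDSS_of_pumpWitness {lam : ℝ} (hlam : 1 < lam)
    (coeff : Fin m → Fin m → Fin m → Option (Fin 3) → ℝ) (X : Fin m → ℤ → ℝ → ℝ)
    (hode : SolvesODE lam coeff X) (hdss : IsDSS lam 1 X) (hTI : IsTypeI lam X) (hnt : IsNontrivial X) {M : ℝ}
    (hact : ∀ n : ℤ, IntegrableOn (fun t => ‖shellVec X n t‖) (Iio 0) ∧
      lam ^ n * ∫ t in Iio 0, ‖shellVec X n t‖ ≤ M)
    (hbd : ∀ n : ℤ, ∃ P : ℝ, ∀ t : ℝ, -(1 / 2) ≤ t → t < 0 → ‖shellVec X n t‖ ≤ P) :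
    ∃ (ε₀ : ℝ) (W : ℤ → ℝ → Em m), 0 < ε₀ ∧ (1 + ε₀) ^ ((5 : ℝ) / 2) = lam ∧
      IsEternalVisc ε₀ 1 (fun (i₁ i₂ i₃ : Fin m) (μ : ℤ × ℤ × ℤ) =>
        if μ = (0, 0, 0) then coeff i₁ i₂ i₃ none
        else if μ = (1, 0, 0) then coeff i₁ i₂ i₃ (some 0)
        else if μ = (0, 1, 0) then coeff i₁ i₂ i₃ (some 1)
        else if μ = (0, 0, 1) then coeff i₁ i₂ i₃ (some 2) else 0) W ∧
      UniformBound W ∧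
      (∀ (n : ℤ) (σ : ℝ), W (n + 1) σ = W n (σ - 2 * Real.log (1 + ε₀))) ∧
      (∃ (n : ℤ) (σ : ℝ), W n σ ≠ 0) := by
  obtain ⟨hε, hlamε, hΛ⟩ := eps_of_lam hlam
  set ε₀ : ℝ := lam ^ (2 / 5 : ℝ) - 1 with hε₀
  have hpos : 0 < lam := by linarith
  have hb : (0 : ℝ) < 1 + ε₀ := by linarith
  refine ⟨ε₀, fun n σ => Real.exp (-σ) • (bigLam ε₀ ^ n • shellVec X n (0 - Real.exp (-σ))), hε, hlamε,
    ?_, ?_, ?_, ?_⟩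
  · -- the law, the action and the forward bound: `isEternalVisc_of_ancient` on the dictionary form of `SolvesODE`
    refine isEternalVisc_of_ancient (M := M) hε zero_le_one (fun i n t ht => ?_) (fun n => ?_) hbd
    · have h := hode i n t ht
      rw [rhsF_eq_quadTerm_sub hb hlamε coeff X i n t] at h
      exact h
    · rw [hΛ]
      exact hact n
  · -- uniform bound: the lattice clock of brick 1, in shell-vector form
    obtain ⟨K, hK⟩ := typeI_clock_bound hlam coeff X hode hTI
    have hK0 : 0 ≤ K := by
      obtain ⟨i, -, -⟩ := hnt
      have h := hK i 0 (-1) (by norm_num)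
      have h1 : 0 ≤ lam ^ (((0 : ℤ) : ℝ)) * (-(-1 : ℝ)) * |X i 0 (-1)| :=
        mul_nonneg (mul_nonneg (Real.rpow_nonneg hpos.le _) (by norm_num)) (abs_nonneg _)
      exact h1.trans h
    refine uniformBound_of_clock (K := m * K) hε fun n t ht => ?_
    rw [hΛ, ← Real.rpow_intCast]
    have hcomp : ∀ j : Fin m, |X j n t| ≤ K / (lam ^ (n : ℝ) * (-t)) := by
      intro j
      have hw : 0 < lam ^ (n : ℝ) * (-t) := mul_pos (Real.rpow_pos_of_pos hpos _) (neg_pos.2 ht)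
      rw [le_div_iff₀ hw]
      have := hK j n t ht
      linarith [this, mul_comm (lam ^ (n : ℝ) * (-t)) (|X j n t|)]
    have hw : 0 < lam ^ (n : ℝ) * (-t) := mul_pos (Real.rpow_pos_of_pos hpos _) (neg_pos.2 ht)
    have hnorm : ‖shellVec X n t‖ ≤ ∑ j : Fin m, |X j n t| := by
      rw [EuclideanSpace.norm_eq]
      refine (Real.sqrt_le_sqrt (Finset.sum_le_sum fun j _ => le_refl _)).trans ?_
      have h0 : ∀ j ∈ (Finset.univ : Finset (Fin m)), 0 ≤ |X j n t| := fun j _ => abs_nonneg _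
      calc √(∑ j : Fin m, ‖shellVec X n t j‖ ^ 2) = √(∑ j : Fin m, |X j n t| ^ 2) := by
            simp [shellVec_apply, Real.norm_eq_abs]
        _ ≤ ∑ j : Fin m, |X j n t| := by
            rw [Real.sqrt_le_left (Finset.sum_nonneg h0)]
            exact Finset.sum_sq_le_sq_sum_of_nonneg h0
    have hsum : ∑ j : Fin m, |X j n t| ≤ m * (K / (lam ^ (n : ℝ) * (-t))) := by
      calc ∑ j : Fin m, |X j n t| ≤ ∑ _j : Fin m, K / (lam ^ (n : ℝ) * (-t)) := Finset.sum_le_sum fun j _ => hcomp j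
        _ = m * (K / (lam ^ (n : ℝ) * (-t))) := by simp
    have htne : t ≠ 0 := ht.ne
    have hlne : lam ^ (n : ℝ) ≠ 0 := (Real.rpow_pos_of_pos hpos _).ne'
    calc lam ^ (n : ℝ) * (-t) * ‖shellVec X n t‖ ≤ lam ^ (n : ℝ) * (-t) * (m * (K / (lam ^ (n : ℝ) * (-t)))) :=
          mul_le_mul_of_nonneg_left (hnorm.trans hsum) hw.le
      _ = m * K := by field_simp
  · -- block self-similarity with the pinned lag `T = (4/5) log Λ = 2 log (1+ε₀)`
    intro n σ
    have hT : 2 * Real.log (1 + ε₀) = (4 / 5 : ℝ) * Real.log (bigLam ε₀) := by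
      rw [hΛ, ← hlamε, Real.log_rpow hb]
      ring
    rw [hT]
    refine blockShift_of_dss hε (fun i k t ht => ?_) n σ
    have h := hdss i k t ht
    rw [hΛ]
    simpa using h
  · -- non-triviality: `W_n(-log(-t)) = Λ^n (-t) • x_n(t)`
    obtain ⟨i, n, t, ht, hX⟩ := hnt
    refine ⟨n, -Real.log (-t), ?_⟩
    have hnt' : 0 < -t := neg_pos.2 ht
    have he : Real.exp (-(-Real.log (-t))) = -t := by rw [neg_neg, Real.exp_log hnt']
    show Real.exp (-(-Real.log (-t))) • (bigLam ε₀ ^ n • shellVec X n (0 - Real.exp (-(-Real.log (-t))))) ≠ 0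
    rw [he, show (0 : ℝ) - -t = t by ring]
    intro h0
    have h1 := congrArg (fun v : Em m => v i) h0
    simp only [PiLp.smul_apply, smul_eq_mul, shellVec_apply, PiLp.zero_apply, mul_eq_zero] at h1
    have hΛn : bigLam ε₀ ^ n ≠ 0 := (zpow_pos (bigLam_pos (by linarith)) n).ne'
    rcases h1 with h1 | h1 | h1
    · linarith
    · exact hΛn h1
    · exact hX h1

end Summit.NavierStokesRegularity.NavierStokesRegularity.Theorems.WakeRatchetCircuitPumpAssembly

end
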